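import Mathlib
import HarnessLib
import Summits.HubbardSuperconductivity.HubbardSuperconductivity.Theorems.KLProgrammeKLRegimeTwoVolumeTowerBaseGridDataMMk
import Summits.HubbardSuperconductivity.HubbardSuperconductivity.Theorems.KLProgrammeKLRegimeTwoVolumeTowerBaseGridFrameSwapData
import Summits.HubbardSuperconductivity.HubbardSuperconductivity.Theorems.KLProgrammeKLRegimeVolumeLimitV11GridProfileDoors
import Summits.HubbardSuperconductivity.HubbardSuperconductivity.Theorems.KLProgrammeKLRegimeVolumeLimitV11HinstDoors
import Summits.HubbardSuperconductivity.HubbardSuperconductivity.Theorems.KLProgrammeKLRegimeAlphaWtFlowDeep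
import Summits.HubbardSuperconductivity.HubbardSuperconductivity.Theorems.KLProgrammeKLRegimeTwoVolumeSectionalMomentFrameOK
import Summits.HubbardSuperconductivity.HubbardSuperconductivity.Theorems.KLProgrammeKLRegimeTwoVolumeSliceFrameDefect
import Summits.HubbardSuperconductivity.HubbardSuperconductivity.Theorems.KLProgrammeKLRegimeTwoVolumeTowerGenericFacts
import Summits.HubbardSuperconductivity.HubbardSuperconductivity.Theorems.KLProgrammeKLRegimeEngineTwoLegStepV17FDoor

/-!
# Route `KLProgramme` — crux K3, VL child `KLRegimeVolumeLimitV17F2` (stmt-HubbardSuperconductivity-20440), atom HB1, GRID HALF (assembly step G3-4):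
# THE ATOM `Hgrid‴` IS A THEOREM — eventually-in-`L` `TowerGridDataM` at the tower's top flow frames with volume-free constants, the four smallness
# conditions and the five rates, FROM THE TOWER under regime doors (cell gate-hubbard-kl, seat p3 g18; `--supports` 20440)

The grid half of atom HB1 (k3c4-p1's DISCHARGER-GUIDE-g16 §2 `Hgrid`, re-keyed to the first-moment form `TowerGridDataM` after the located defect «GRID-CT-BUDGET»)
asks, for every `(G, P, Q, R)` and every tower `TowerP klPredsV17F2 …` in the KL regime, for 21 volume-free constants, four `θ < 1`, five rates `→ 0` and,
eventually in `L` (uniformly in `b`, `M` above a threshold), `Nonempty (TowerGridDataM L b M β U μ K_L K_{bL} ε_M …)` at the radii `R_L = ⌊√(L/(4n_β+7))⌋`,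
`R′_L = L/(4n_β+7) − R_L`.  This file proves it, by `…GridDataMMk.towerGridDataM_mk` at each instance, from the landed suppliers: admissible flow frames from the
tower (`frameOK_klFlowFrameU_of_histP_le` ∘ `histP_top_of_towerP`), rows (`exists_uvAlpha_uniform`), frame swap (`frameSwap_gridDataD_of_towerV17F2`), sectional tails
(`sum_far_norm_gridSub_hubbardCovAboveCT_sectional_le_of_frameOK`), first moments (`frameKernel_weightedL1_le`), the frame increment
(`coeffNorm_fsub_klFlowFrameU_le_of_towerV17F2`), the degree guard (`degree_klFlowFrameU_le`), with the constants of `…V11GridProfileDoors` (all depending on `R`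
only) and the doors `c ≤ min(log 4/4, s·log 4/2, klCurveC3 R)`, `U ≤ min(1/4, s/2, klCurveU0 R)`, `s = κ²/(64·e·A₁·Σ)`.

* **`hgridM_of_towerV17F2`** — the `Hgrid‴` text.

Proofs only; no definition.  Honest framing: explicit-constant bookkeeping over landed bounds; nothing here asserts HB1, any stub of 20440, K3, VL or
superconductivity.  [cite: BenfattoGiulianiMastropietro2006, §2.1 (2.5), §2.5 (2.52)–(2.55), §2.7 (2.70)–(2.71a), §3 (3.3)]
-/

noncomputable section

namespace Summit.HubbardSuperconductivity.HubbardSuperconductivity.Theorems.TwoVolumeSource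

set_option linter.dupNamespace false -- summit = problem name (single-conjunct summit), D-0017

open Finset Filter Topology Literature.MathematicalPhysics.QuantumLattice GrassmannAlgebra Literature.Probability.LatticeModels
  Literature.Probability.LatticeModels.BattleFederbush
open Literature.MathematicalPhysics.QuantumLattice.FermiRG
open Summit.HubbardSuperconductivity.HubbardSuperconductivity.Theorems.KLRegimeSplit
open Summit.HubbardSuperconductivity.HubbardSuperconductivity.Theorems.KLProgrammeLegKernels
open Summit.HubbardSuperconductivity.HubbardSuperconductivity.Theorems.TwoPointAssembly
open Summit.HubbardSuperconductivity.HubbardSuperconductivity.Theorems.EngineV8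
open Summit.HubbardSuperconductivity.HubbardSuperconductivity.Theorems.TwoVolumeDefect
open Summit.HubbardSuperconductivity.HubbardSuperconductivity.Theorems.TorusFourierL2
open Summit.HubbardSuperconductivity.HubbardSuperconductivity.Theorems.PerturbedFermiCurve

set_option maxHeartbeats 3200000 in -- explicit-constant bookkeeping, one structure instance per volume pair
/-- **`Hgrid‴` FROM THE TOWER** (see the module docstring). [cite: BenfattoGiulianiMastropietro2006, §2.1 (2.5), §2.5 (2.52)–(2.55), §2.7 (2.70)–(2.71a), §3 (3.3)] -/
theorem hgridM_of_towerV17F2 (G : GeoConsts) (P : SplitConsts) (Q : EngConsts) (R : RenConsts) (hR2 : R.WF2) :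
    ∃ c₇ : ℝ, 0 < c₇ ∧ ∀ c : ℝ, 0 < c → c ≤ c₇ → ∃ U₇ : ℝ, 0 < U₇ ∧
      ∀ μ ∈ klWindowC, ∀ U : ℝ, 0 < U → U ≤ U₇ → ∀ β : ℝ, klBetaMin ≤ β → β ≤ Real.exp (c / U ^ 2) →
        ∀ (K : TrigPolyC4v) (Lstar : ℕ) (Mstar : ℕ → ℕ), TowerP klPredsV17F2 G P Q R β U μ K Lstar Mstar →
        ∃ (κE aC cb κg κg' ρS ρg' ρg₂ ρgf aw al al' mo mo' s s' Θ νW νf νg₂ νD : ℝ) (sgE cc eE tT Te : ℕ → ℝ),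
          (0 < κE ∧ 0 < aC ∧ 0 < κg ∧ 0 < κg' ∧ 0 < ρS ∧ 0 < ρg' ∧ 0 < ρg₂ ∧ 0 < ρgf ∧ 0 < aw ∧ 0 < al' + al ∧ 0 ≤ mo ∧ 0 ≤ mo' ∧ 0 ≤ s ∧ 0 ≤ s' ∧
            0 ≤ Θ ∧ 0 ≤ νW ∧ 0 ≤ νf ∧ 0 ≤ νg₂) ∧
          (Real.exp 1 * (aC + cb) * νW / κE ^ 2 < 1 ∧ Real.exp 1 * aw * Θ / κg' ^ 2 < 1 ∧
            Real.exp 1 * (al' + al + (mo' + mo)) * νf / (κg' + κg) ^ 2 < 1 ∧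
            Real.exp 1 * (al' + al + (mo' + mo)) * νg₂ / (κg' + κg + (κg' + κg + (κg' + κg))) ^ 2 < 1) ∧
          (∀ L, 0 ≤ sgE L ∧ 0 ≤ cc L ∧ 2 * cc L ≤ cb ∧ 0 < tT L ∧ 0 ≤ Te L) ∧
          (Tendsto sgE atTop (𝓝 0) ∧ Tendsto cc atTop (𝓝 0) ∧ Tendsto eE atTop (𝓝 0) ∧ Tendsto tT atTop (𝓝 0) ∧ Tendsto Te atTop (𝓝 0)) ∧
        ∃ L₂ : ℕ, ∃ M₂ : ℕ → ℕ → ℕ, ∀ (L b M : ℕ) [NeZero L] [NeZero (b * L)] [NeZero M], L₂ ≤ L → M₂ L b ≤ M →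
          Nonempty (TowerGridDataM L b M β U μ (klFlowFrameU L M β U μ (nScales β + 1)) (klFlowFrameU (b * L) M β U μ (nScales β + 1)) (imagTimeWeight β M)
            κE aC κg κg' ρS ρg' ρg₂ ρgf aw al al' mo mo' s s' Θ νW νf νg₂ νD
            (sgE L) (cc L) (eE L) (tT L) (Te L) (Nat.sqrt (L / (4 * nScales β + 7))) ((L / (4 * nScales β + 7)) - Nat.sqrt (L / (4 * nScales β + 7)))) := by
  have hR : R.WF := hR2.wf
  have hGfr : ∀ j, 0 ≤ R.Gfr j := hR.2.2
  obtain ⟨Ag, hAg⟩ := exists_uvAlpha_uniform R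
  have hlog : 0 < Real.log 4 := Real.log_pos (by norm_num)
  have he0 : 0 < Real.exp 1 := Real.exp_pos 1
  have he3 : Real.exp 1 < 3 := lt_trans Real.exp_one_lt_d9 (by norm_num)
  -- constants depending on `R` only
  set A₁ : ℝ := max Ag 0 + 1 with hA₁def
  have hA₁ : 0 < A₁ := by
    have h0 := le_max_right Ag 0
    rw [hA₁def]; linarith only [h0]
  have hAgA : Ag ≤ A₁ := by
    have h0 := le_max_left Ag 0
    rw [hA₁def]; linarith only [h0]
  set κ : ℝ := Real.sqrt (2 * (7 + 6593)) with hκdef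
  have hκ : 0 < κ := Real.sqrt_pos.2 (by norm_num)
  set C₁ : ℝ := 6 * (Real.pi * R.Gfr 1 / 2 + Real.pi ^ 2 * R.Gfr 2 / (2 * Real.sqrt 2) + Real.pi ^ 3 * R.Gfr 3 / 8) with hC₁
  have hC₁0 : 0 ≤ C₁ := by have := hGfr 1; have := hGfr 2; have := hGfr 3; positivity
  have hKF : 0 < klKappaFrameC R := klKappaFrameC_pos (hGfr 0)
  set CF : ℝ := klKappaFrameC R + 2 * C₁ with hCF
  have hCF0 : 0 ≤ CF := by positivity
  set ρg : ℝ := 4 * Real.exp 2 * (6 * κ + 1) with hρg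
  have hρg0 : 0 < ρg := by positivity
  set Θg : ℝ := ((Real.exp 2 * (κ + ρg)) ^ 2 * CF + (Real.exp 2 * (κ + ρg)) ^ 4) / 2 with hΘg
  set ΘW : ℝ := ((Real.exp 2 * (κ + κ + 1)) ^ 2 * CF + (Real.exp 2 * (κ + κ + 1)) ^ 4) / 2 with hΘW
  set Θ₁ : ℝ := ((Real.exp 2 * (κ + 1)) ^ 2 * CF + (Real.exp 2 * (κ + 1)) ^ 4) / 2 with hΘ₁
  set w₁ : ℝ := (Real.exp 2 * (κ + 1)) ^ 2 with hw₁
  have hΘg0 : 0 ≤ Θg := by positivity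
  have hΘW0 : 0 ≤ ΘW := by positivity
  have hΘ₁0 : 0 ≤ Θ₁ := by positivity
  have hw₁0 : 0 ≤ w₁ := by positivity
  set Sg : ℝ := Θg + ΘW + Θ₁ + w₁ * CF + w₁ + 1 with hSg
  have hwCF : 0 ≤ w₁ * CF := mul_nonneg hw₁0 hCF0
  have hΘgS : Θg ≤ Sg := by rw [hSg]; linarith only [hwCF, hΘW0, hΘ₁0, hw₁0]
  have hSg1 : 1 ≤ Sg := by rw [hSg]; linarith only [hwCF, hΘg0, hΘW0, hΘ₁0, hw₁0]
  have hSg0 : 0 < Sg := by linarith only [hSg1]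
  set s₀ : ℝ := κ ^ 2 / (64 * Real.exp 1 * A₁ * Sg) with hs₀
  have hs₀0 : 0 < s₀ := by positivity
  have hC3 : 0 < klCurveC3 R := klCurveC3_pos hGfr
  have hU0R : 0 < klCurveU0 R := klCurveU0_pos hGfr
  -- the doors
  refine ⟨min (min (Real.log 4 / 4) (s₀ * Real.log 4 / 2)) (klCurveC3 R), lt_min (lt_min (by positivity) (by positivity)) hC3, fun c hc hcc => ?_⟩
  refine ⟨min (min (1 / 4) (s₀ / 2)) (klCurveU0 R), lt_min (lt_min (by norm_num) (by positivity)) hU0R,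
    fun μ hμ U hU hUU β hβmin hβc K₀ Lstar Mstar hT => ?_⟩
  have hβ : 0 < β := KLRegimeSplit.pos_of_klBetaMin_le hβmin
  have hβ1 : 1 ≤ β := le_trans (by norm_num [klBetaMin]) hβmin
  have hcC3 : c ≤ klCurveC3 R := hcc.trans (min_le_right _ _)
  have hUU0 : U ≤ klCurveU0 R := hUU.trans (min_le_right _ _)
  have hcs : c / Real.log 4 ≤ s₀ / 2 := by
    rw [div_le_iff₀ hlog]; have h := (hcc.trans (min_le_left _ _)).trans (min_le_right _ _); linarith only [h]
  have hUs : U ≤ s₀ / 2 := (hUU.trans (min_le_left _ _)).trans (min_le_right _ _)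
  have hU4 : U ≤ 1 / 4 := (hUU.trans (min_le_left _ _)).trans (min_le_left _ _)
  have hUabs : |U| = U := abs_of_pos hU
  have hU1 : |U| ≤ 1 := by rw [hUabs]; linarith only [hU4]
  have hnU : U ^ 2 * ((nScales β : ℝ) + 1) ≤ c / Real.log 4 := sq_mul_nScales_succ_le hc.le hβmin hβc
  have hNU : ((nScales β : ℝ) + 1) * U ^ 2 + 2 * |U| ≤ 3 := by
    rw [hUabs]
    have hc4 : c / Real.log 4 ≤ 1 / 4 := by
      rw [div_le_iff₀ hlog]; have h := (hcc.trans (min_le_left _ _)).trans (min_le_left _ _); linarith only [h]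
    have hU2 : 0 ≤ U := hU.le
    nlinarith only [hnU, hc4, hU4, hU2]
  -- the small parameter `t := |U| + c/log 4 ≤ s₀` and the uniform first-moment bound `F := CF·t`
  set t : ℝ := |U| + c / Real.log 4 with ht
  have ht0 : 0 ≤ t := by positivity
  have hcl0 : 0 ≤ c / Real.log 4 := by positivity
  have hts : t ≤ s₀ := by rw [ht, hUabs]; linarith only [hUs, hcs]
  have hUt : |U| ≤ t := by rw [ht]; linarith only [hcl0]
  set F : ℝ := CF * t with hF
  have hF0 : 0 ≤ F := by positivity
  have hFs : F ≤ CF * s₀ := mul_le_mul_of_nonneg_left hts hCF0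
  have hFK : ∀ {V : ℕ} [NeZero V] {K' : TrigPolyC4v}, FrameOK R U (nScales β) μ K' →
      ∑ z : TorusSite 2 V, ‖framePosKernel V K' z‖ * (1 + torusSiteDist z 0) ≤ F := by
    intro V _ K' hK'
    refine (frameKernel_weightedL1_le (L := V) hR hU.ne' hU1 hK').trans ?_
    have h1 : ((nScales β : ℝ) + 1) * U ^ 2 * C₁ ≤ C₁ * (c / Real.log 4) := by
      have h := mul_le_mul_of_nonneg_left hnU hC₁0
      linarith only [h]
    have h2 : klKappaFrameC R * |U| ≤ klKappaFrameC R * t := mul_le_mul_of_nonneg_left hUt hKF.le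
    have hct : c / Real.log 4 ≤ t := by rw [ht]; linarith only [abs_nonneg U]
    have h3 : C₁ * (c / Real.log 4) ≤ C₁ * t := mul_le_mul_of_nonneg_left hct hC₁0
    rw [hF, hCF, hC₁] at *
    linarith only [h1, h2, h3]
  -- the frame-swap constant and the frame-increment weight of the tower
  obtain ⟨Csw, hCsw0, hCsw⟩ := frameSwap_gridDataD_of_towerV17F2 hμ hβ1 hT
  set c₀ : ℝ := ∑ m ∈ range (nScales β + 1), 4 * (2 * (klFlowDeg m : ℝ) + 1) * (1 + 4 * (klFlowDeg m : ℝ)) ^ 0 * Q.CL β m with hc₀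
  -- the sectional constant at `Λ₁`
  set Λ₁ : ℝ := klScale klE0 1 with hΛ₁
  have hΛ1 : 0 < Λ₁ := klth_klScale_pos 1
  set Dβ : ℝ := 5 + R.Gfr 3 * U ^ 2 * ((4 : ℝ) ^ (nScales β + 1) / 3) with hDβ
  have hDβ0 : 0 ≤ Dβ := by have h3 := hGfr 3; rw [hDβ]; positivity
  set Csec : ℝ := 96 * 3960000 * (2 * Real.pi * (1 + 4 / Λ₁) * Dβ + 12 * Real.pi ^ 2 * (1 + 4 / Λ₁) ^ 2 * Dβ ^ 2 +
      144 * Real.pi ^ 3 * (1 + 4 / Λ₁) ^ 3 * Dβ ^ 3) / Λ₁ with hCsec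
  have hCsec0 : 0 ≤ Csec := by positivity
  -- the degree guard
  set Dg : ℕ := 2 * klFlowDeg (nScales β + 1) with hDg
  -- the smallness number of the coarse grid step
  set θb : ℝ := Real.exp 1 * (2 * A₁) * (Θg * s₀) / κ ^ 2 with hθb
  have hθbv : θb = Θg / (32 * Sg) := by
    rw [hθb, hs₀]; field_simp; ring
  have hθb1 : θb ≤ 1 / 32 := by
    rw [hθbv, div_le_div_iff₀ (by positivity) (by norm_num)]
    linarith only [hΘgS]
  have hθb0 : 0 ≤ θb := by rw [hθb]; positivity
  -- the geometric ratios
  have he2 : 0 < Real.exp 2 := Real.exp_pos 2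
  have hqfv : Real.exp 2 * (κ + κ + 1) * ρg⁻¹ = (κ + κ + 1) / (4 * (6 * κ + 1)) := by
    rw [hρg]; field_simp
  have hq₂v : Real.exp 2 * (κ + κ + (κ + κ + (κ + κ)) + 1) * ρg⁻¹ = 1 / 4 := by
    rw [hρg]; field_simp; ring
  have hqfh : Real.exp 2 * (κ + κ + 1) * ρg⁻¹ ≤ 1 / 2 := by
    rw [hqfv, div_le_iff₀ (by positivity)]; linarith only [hκ]
  have hqf : Real.exp 2 * (κ + κ + 1) * ρg⁻¹ < 1 := by linarith only [hqfh]
  have hq₂ : Real.exp 2 * (κ + κ + (κ + κ + (κ + κ)) + 1) * ρg⁻¹ < 1 := by rw [hq₂v]; norm_num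
  have hqf0 : 0 ≤ Real.exp 2 * (κ + κ + 1) * ρg⁻¹ := by positivity
  have hqf' : (Real.exp 2 * (κ + κ + 1) * ρg⁻¹) ^ 2 ≤ 1 / 4 := by nlinarith only [hqfh, hqf0]
  have hq₂' : (Real.exp 2 * (κ + κ + (κ + κ + (κ + κ)) + 1) * ρg⁻¹) ^ 2 ≤ 1 / 4 := by rw [hq₂v]; norm_num
  -- the output-profile budgets `νf, ν₂ ≤ (64/45)·e·Θg·s₀`
  have hνf_le : ∀ q : ℝ, q ^ 2 ≤ 1 / 4 → Real.exp 1 * (Θg * s₀) / (1 - θb) / (1 - q ^ 2) ≤ 64 / 45 * (Real.exp 1 * (Θg * s₀)) := by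
    intro q hq
    have h1 : 31 / 32 ≤ 1 - θb := by linarith only [hθb1]
    have h2 : 3 / 4 ≤ 1 - q ^ 2 := by linarith only [hq]
    have hnum : 0 ≤ Real.exp 1 * (Θg * s₀) := by positivity
    have hprod : 93 / 128 ≤ (1 - θb) * (1 - q ^ 2) := by nlinarith only [h1, h2]
    rw [div_div, div_le_iff₀ (by linarith only [hprod])]
    nlinarith only [hprod, hnum]
  -- ### the constants, positivity, smallness, rates
  refine ⟨κ + κ, 2 * A₁, 2 * A₁, κ, κ, 1, 1, 1, 1, 2 * A₁, 2 * A₁, 2 * A₁, 2 * A₁, 2 * A₁, 2 * (7 + 6593), 2 * (7 + 6593),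
    ((Real.exp 2 * (Real.sqrt (2 * (7 + 6593)) + 1)) ^ 2 * F + (Real.exp 2 * (Real.sqrt (2 * (7 + 6593)) + 1)) ^ 4 * |U|) / 2 +
      (Real.exp 2 * (Real.sqrt (2 * (7 + 6593)) + 1)) ^ 2 * F + (Real.exp 2 * (Real.sqrt (2 * (7 + 6593)) + 1)) ^ 2 * s₀ / 2,
    ((Real.exp 2 * (Real.sqrt (2 * (7 + 6593)) + Real.sqrt (2 * (7 + 6593)) + 1)) ^ 2 * F +
      (Real.exp 2 * (Real.sqrt (2 * (7 + 6593)) + Real.sqrt (2 * (7 + 6593)) + 1)) ^ 4 * |U|) / 2,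
    Real.exp 1 * (Θg * s₀) / (1 - θb) / (1 - (Real.exp 2 * (Real.sqrt (2 * (7 + 6593)) + Real.sqrt (2 * (7 + 6593)) + 1) * ρg⁻¹) ^ 2),
    Real.exp 1 * (Θg * s₀) / (1 - θb) / (1 - (Real.exp 2 * (Real.sqrt (2 * (7 + 6593)) + Real.sqrt (2 * (7 + 6593)) +
      (Real.sqrt (2 * (7 + 6593)) + Real.sqrt (2 * (7 + 6593)) + (Real.sqrt (2 * (7 + 6593)) + Real.sqrt (2 * (7 + 6593)))) + 1) * ρg⁻¹) ^ 2),
    (Real.exp 2 * (Real.sqrt (2 * (7 + 6593)) + 1)) ^ 2 * F,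
    fun L => Csw / L, fun L => min (Csw / L) A₁, fun L => (Real.exp 2 * (Real.sqrt (2 * (7 + 6593)) + 1)) ^ 2 * (c₀ / L) / 2,
    fun L => 2 * A₁ / ((Nat.sqrt (L / (4 * nScales β + 7)) : ℝ) + 1), fun L => Csec / ((Nat.sqrt (L / (4 * nScales β + 7)) : ℝ) + 1),
    ?_, ?_, ?_, ?_, ?_⟩
  · -- positivity of the constants
    refine ⟨by positivity, by positivity, hκ, hκ, one_pos, one_pos, one_pos, one_pos, by positivity, by positivity, by positivity, by positivity,
      by norm_num, by norm_num, by positivity, by positivity, ?_, ?_⟩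
    · have : 0 < 1 - θb := by linarith only [hθb1]
      have : 0 < 1 - (Real.exp 2 * (κ + κ + 1) * ρg⁻¹) ^ 2 := by linarith only [hqf']
      positivity
    · have : 0 < 1 - θb := by linarith only [hθb1]
      have : 0 < 1 - (Real.exp 2 * (κ + κ + (κ + κ + (κ + κ)) + 1) * ρg⁻¹) ^ 2 := by linarith only [hq₂']
      positivity
  · -- the four smallness conditions
    rw [← hκdef]
    have e2 : 0 ≤ (Real.exp 2 * (κ + κ + 1)) ^ 2 := by positivity
    have e4 : 0 ≤ (Real.exp 2 * (κ + κ + 1)) ^ 4 := by positivity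
    have f2 : 0 ≤ (Real.exp 2 * (κ + 1)) ^ 2 := by positivity
    have f4 : 0 ≤ (Real.exp 2 * (κ + 1)) ^ 4 := by positivity
    have hUs' : |U| ≤ s₀ := hUt.trans hts
    have hνW : ((Real.exp 2 * (κ + κ + 1)) ^ 2 * F + (Real.exp 2 * (κ + κ + 1)) ^ 4 * |U|) / 2 ≤ ΘW * s₀ := by
      rw [hΘW]
      linarith only [mul_le_mul_of_nonneg_left hFs e2, mul_le_mul_of_nonneg_left hUs' e4]
    have hΘ : ((Real.exp 2 * (κ + 1)) ^ 2 * F + (Real.exp 2 * (κ + 1)) ^ 4 * |U|) / 2 + (Real.exp 2 * (κ + 1)) ^ 2 * F +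
        (Real.exp 2 * (κ + 1)) ^ 2 * s₀ / 2 ≤ Sg * s₀ := by
      have hrest : 0 ≤ (Θg + ΘW + 1) * s₀ := by positivity
      have hfs : 0 ≤ (Real.exp 2 * (κ + 1)) ^ 2 * s₀ := mul_nonneg f2 hs₀0.le
      rw [hSg, hΘ₁, hw₁]
      linarith only [mul_le_mul_of_nonneg_left hFs f2, mul_le_mul_of_nonneg_left hUs' f4, hrest, hfs]
    have hνW0 : 0 ≤ ((Real.exp 2 * (κ + κ + 1)) ^ 2 * F + (Real.exp 2 * (κ + κ + 1)) ^ 4 * |U|) / 2 := by positivity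
    have hν64 : 0 ≤ 64 / 45 * (Real.exp 1 * (Θg * s₀)) := by positivity
    have hΘS : Θg / Sg ≤ 1 := by rw [div_le_one hSg0]; exact hΘgS
    have hΘS0 : 0 ≤ Θg / Sg := by positivity
    refine ⟨?_, ?_, ?_, ?_⟩
    · -- `e·(aC + cb)·νW/κE² ≤ e·4A₁·ΘW·s₀/(2κ)² = ΘW/(64 Sg) < 1`
      have hval : Real.exp 1 * (2 * A₁ + 2 * A₁) * (ΘW * s₀) / (κ + κ) ^ 2 = ΘW / (64 * Sg) := by rw [hs₀]; field_simp; ring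
      have hlt : ΘW / (64 * Sg) < 1 := by
        rw [div_lt_one (by positivity), hSg]; linarith only [hwCF, hΘg0, hΘW0, hΘ₁0, hw₁0]
      refine lt_of_le_of_lt ?_ (hval.le.trans_lt hlt)
      exact div_le_div_of_nonneg_right (mul_le_mul_of_nonneg_left hνW (by positivity)) (sq_nonneg _)
    · have hval : Real.exp 1 * (2 * A₁) * (Sg * s₀) / κ ^ 2 = 1 / 32 := by rw [hs₀]; field_simp; ring
      refine lt_of_le_of_lt ?_ (hval.le.trans_lt (by norm_num))
      exact div_le_div_of_nonneg_right (mul_le_mul_of_nonneg_left hΘ (by positivity)) (sq_nonneg _)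
    · have hν := hνf_le _ hqf'
      have hval : Real.exp 1 * (2 * A₁ + 2 * A₁ + (2 * A₁ + 2 * A₁)) * (64 / 45 * (Real.exp 1 * (Θg * s₀))) / (κ + κ) ^ 2 =
          Real.exp 1 * (2 / 45) * (Θg / Sg) := by rw [hs₀]; field_simp
      have hlt : Real.exp 1 * (2 / 45) * (Θg / Sg) < 1 := by nlinarith only [hΘS, hΘS0, he3, he0]
      refine lt_of_le_of_lt ?_ (hval.le.trans_lt hlt)
      exact div_le_div_of_nonneg_right (mul_le_mul_of_nonneg_left hν (by positivity)) (sq_nonneg _)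
    · have hν := hνf_le _ hq₂'
      have hval : Real.exp 1 * (2 * A₁ + 2 * A₁ + (2 * A₁ + 2 * A₁)) * (64 / 45 * (Real.exp 1 * (Θg * s₀))) / (κ + κ + (κ + κ + (κ + κ))) ^ 2 =
          Real.exp 1 * (2 / 405) * (Θg / Sg) := by rw [hs₀]; field_simp; ring
      have hlt : Real.exp 1 * (2 / 405) * (Θg / Sg) < 1 := by nlinarith only [hΘS, hΘS0, he3, he0]
      refine lt_of_le_of_lt ?_ (hval.le.trans_lt hlt)
      exact div_le_div_of_nonneg_right (mul_le_mul_of_nonneg_left hν (by positivity)) (sq_nonneg _)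
  · -- the caps of the rates
    intro L
    refine ⟨div_nonneg hCsw0 (Nat.cast_nonneg L), le_min (div_nonneg hCsw0 (Nat.cast_nonneg L)) hA₁.le, ?_, by positivity, by positivity⟩
    linarith only [min_le_right (Csw / (L : ℝ)) A₁]
  · -- the rates tend to `0`
    have hsw : Tendsto (fun L : ℕ => Csw / (L : ℝ)) atTop (𝓝 0) := tendsto_const_div_atTop_nhds_zero_nat Csw
    have hsq : Tendsto (fun L : ℕ => ((Nat.sqrt (L / (4 * nScales β + 7)) : ℝ) + 1)) atTop atTop :=
      tendsto_atTop_add_const_right _ 1 (tendsto_natCast_atTop_atTop.comp (tower_radii_sqrt _ (tower_radius_tendsto β)).2.2.2)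
    refine ⟨hsw, squeeze_zero (fun L => le_min (div_nonneg hCsw0 (Nat.cast_nonneg L)) hA₁.le) (fun L => min_le_left _ _) hsw, ?_,
      tendsto_const_nhds.div_atTop hsq, tendsto_const_nhds.div_atTop hsq⟩
    have h := tendsto_const_div_atTop_nhds_zero_nat ((Real.exp 2 * (Real.sqrt (2 * (7 + 6593)) + 1)) ^ 2 * c₀ / 2)
    refine h.congr fun L => ?_
    ring
  -- ### the thresholds and the data at one instance
  refine ⟨Lstar + klEngL₃ β U + ⌈β⌉₊ + ⌈Csw / A₁⌉₊ + ⌈c₀ / s₀⌉₊ + (4 * nScales β + 7) * (Dg + 1) ^ 2 + 2,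
    fun L b => Mstar L + Mstar (b * L) + Q.M0 β L + Q.M0 β (b * L) + klEngM₃ β U L + klEngM₃ β U (b * L) + 2,
    fun L b M _ _ _ hL hM => ?_⟩
  dsimp only at hM
  have hLs : Lstar ≤ L := by omega
  have hL3 : klEngL₃ β U ≤ L := by omega
  have hLβ : ⌈β⌉₊ ≤ L := by omega
  have hLsw : ⌈Csw / A₁⌉₊ + 1 ≤ L := by omega
  have hLc₀ : ⌈c₀ / s₀⌉₊ + 1 ≤ L := by omega
  have hLD : (4 * nScales β + 7) * (Dg + 1) ^ 2 ≤ L := by omega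
  have hMs : Mstar L ≤ M := by omega
  have hMsb : Mstar (b * L) ≤ M := by omega
  have hM0 : Q.M0 β L ≤ M := by omega
  have hM0b : Q.M0 β (b * L) ≤ M := by omega
  have hM3 : klEngM₃ β U L ≤ M := by omega
  have hM3b : klEngM₃ β U (b * L) ≤ M := by omega
  have hM2 : 2 ≤ M := by omega
  have hb1 : 1 ≤ b := Nat.pos_of_ne_zero fun hb => NeZero.ne (b * L) (by rw [hb, Nat.zero_mul])
  have hLbL : L ≤ b * L := Nat.le_mul_of_pos_left L hb1
  have hL3b : klEngL₃ β U ≤ b * L := hL3.trans hLbL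
  have hLsb : Lstar ≤ b * L := hLs.trans hLbL
  have hL0 : (0 : ℝ) < L := Nat.cast_pos.2 (Nat.pos_of_ne_zero (NeZero.ne L))
  have hβL : β ≤ L := (Nat.le_ceil β).trans (by exact_mod_cast hLβ)
  have hn1 : 1 ≤ nScales β + 1 := Nat.le_add_left 1 _
  -- the admissible flow frames of the two volumes
  have hKc : FrameOK R U (nScales β) μ (klFlowFrameU L M β U μ (nScales β + 1)) :=
    frameOK_klFlowFrameU_of_histP_le hR2 hn1 le_rfl le_rfl (histP_top_of_towerP hT hLs hMs)
  have hKf : FrameOK R U (nScales β) μ (klFlowFrameU (b * L) M β U μ (nScales β + 1)) :=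
    frameOK_klFlowFrameU_of_histP_le hR2 hn1 le_rfl le_rfl (histP_top_of_towerP hT hLsb hMsb)
  -- rows at the coarse frame on both lattices
  have h4M : (0 : ℝ) ≤ (((2 * (2 * M) : ℕ) : ℝ)) / β := div_nonneg (Nat.cast_nonneg _) hβ.le
  have hAgle : (((2 * (2 * M) : ℕ) : ℝ)) / β * Ag ≤ (((2 * (2 * M) : ℕ) : ℝ)) / β * A₁ := mul_le_mul_of_nonneg_left hAgA h4M
  obtain ⟨hrowL, hcolL⟩ := hAg hKc hR hU1 hβmin hL3 hM3 hNU
  obtain ⟨hrowF, hcolF⟩ := hAg (L := b * L) hKc hR hU1 hβmin hL3b hM3b hNU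
  -- the frame swap at this instance: `Csw/L ≤ A₁`, so `cc L = Csw/L`
  obtain ⟨hsE, hRr, hCr⟩ := hCsw L b M hLs hMs hM0 hMsb hM0b hM2
  have hswA : Csw / (L : ℝ) ≤ A₁ := by
    rw [div_le_iff₀ hL0]
    have h1 : Csw / A₁ ≤ ⌈Csw / A₁⌉₊ := Nat.le_ceil _
    have h2 : ((⌈Csw / A₁⌉₊ : ℕ) : ℝ) + 1 ≤ L := by exact_mod_cast hLsw
    rw [div_le_iff₀ hA₁] at h1
    nlinarith only [h1, h2, hA₁]
  have hccL : min (Csw / (L : ℝ)) A₁ = Csw / L := min_eq_left hswA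
  -- the frame-increment weight `≤ c₀/L ≤ s₀`
  have he₀ : (fsub (klFlowFrameU (b * L) M β U μ (nScales β + 1)) (klFlowFrameU L M β U μ (nScales β + 1))).coeffNorm 0 ≤ c₀ / L := by
    rw [coeffNorm_fsub_comm]
    exact coeffNorm_fsub_klFlowFrameU_le_of_towerV17F2 hμ hT hLs hLbL hMs hM0 hMsb hM0b le_rfl 0
  have hc₀0 : 0 ≤ c₀ / L := (TrigPolyC4v.coeffNorm_nonneg _ _).trans he₀
  have hē : c₀ / (L : ℝ) ≤ s₀ := by
    rcases le_or_gt c₀ 0 with hneg | hpos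
    · exact (div_nonpos_of_nonpos_of_nonneg hneg hL0.le).trans hs₀0.le
    · rw [div_le_iff₀ hL0]
      have h1 : c₀ / s₀ ≤ ⌈c₀ / s₀⌉₊ := Nat.le_ceil _
      have h2 : ((⌈c₀ / s₀⌉₊ : ℕ) : ℝ) + 1 ≤ L := by exact_mod_cast hLc₀
      rw [div_le_iff₀ hs₀0] at h1
      nlinarith only [h1, h2, hs₀0]
  -- the degree guard `deg K_L < R_L`
  have hRK : (klFlowFrameU L M β U μ (nScales β + 1)).degree < Nat.sqrt (L / (4 * nScales β + 7)) := by
    have hdeg := degree_klFlowFrameU_le L M β U μ (nScales β + 1)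
    have hsq : Dg + 1 ≤ Nat.sqrt (L / (4 * nScales β + 7)) := by
      rw [Nat.le_sqrt, ← pow_two]
      exact (Nat.le_div_iff_mul_le (by omega)).2 (by rw [mul_comm]; exact hLD)
    omega
  -- the smallness data of the coarse grid step
  have hΘ₀ : ((Real.exp 2 * (Real.sqrt (2 * (7 + 6593)) + ρg)) ^ 2 * F + (Real.exp 2 * (Real.sqrt (2 * (7 + 6593)) + ρg)) ^ 4 * |U|) / 2 ≤ Θg * s₀ := by
    rw [← hκdef, hΘg]
    have e2 : 0 ≤ (Real.exp 2 * (κ + ρg)) ^ 2 := by positivity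
    have e4 : 0 ≤ (Real.exp 2 * (κ + ρg)) ^ 4 := by positivity
    linarith only [mul_le_mul_of_nonneg_left hFs e2, mul_le_mul_of_nonneg_left (hUt.trans hts) e4]
  have hθb_le : Real.exp 1 * (2 * A₁) * (Θg * s₀) / Real.sqrt (2 * (7 + 6593)) ^ 2 ≤ θb := by rw [hθb, hκdef]
  have hθb_lt : θb < 1 := by linarith only [hθb1]
  -- the instance
  have hMN : 2 * M ≤ klGridN M := by simp only [klGridN]; omega
  refine ⟨(towerGridDataM_mk (L := L) (b := b) (M := M) hβmin hβL hKc hKf hA₁ (fun X => (hrowL X).trans hAgle) (fun Y => (hcolL Y).trans hAgle)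
    (fun X => (hrowF X).trans hAgle) (fun Y => (hcolF Y).trans hAgle) hsE (fun x => (hRr x).trans (le_of_eq hccL.symm))
    (fun y => (hCr y).trans (le_of_eq hccL.symm)) hRK (R₀' := L / (4 * nScales β + 7) - Nat.sqrt (L / (4 * nScales β + 7)))
    (fun X' τ σ ch => sum_far_norm_gridSub_hubbardCovAboveCT_sectional_le_of_frameOK (L := b * L) (M := M) (N := klGridN M) hMN hGfr hc hcC3 hU hUU0
      hβmin hβc hμ hKc hΛ1 (Nat.sqrt (L / (4 * nScales β + 7))) X' τ σ ch)
    (hFK hKc) (hFK hKf) he₀ hē one_pos one_pos one_pos one_pos hρg0 (by positivity) hΘ₀ hθb_le hθb_lt ?_ ?_).some⟩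
  · rw [← hκdef]; exact hqf
  · rw [← hκdef]; exact hq₂

end Summit.HubbardSuperconductivity.HubbardSuperconductivity.Theorems.TwoVolumeSource

end
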